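import Literature.AlgebraicGeometry.Modules.IdealMul
import Literature.AlgebraicGeometry.Modules.Annihilator
import Literature.AlgebraicGeometry.Modules.CokernelSupport
import Mathlib.RingTheory.Finiteness.Ideal
import HarnessLib

/-!
# Vanishing of a morphism is local on affine sections; uniform torsion of finite modules

Two small "local-to-global" bookkeeping facts for quasi-coherent (affine-localizing) modules on a
scheme, used in the proper case of Grothendieck's existence theorem (The Stacks Project, Tags 088B,
088C) to pass from finitely many affine opens to all opens (companions of the tree's
`IsKilledBy.of_iSup_eq_top` and `exists_isKilledBy_sup_pow` in `Modules/Annihilator`):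

* `eq_zero_of_app_eq_zero_of_iSup_eq_top` — **a morphism out of an affine-localizing module
  vanishes if it vanishes on the sections over an affine open cover** (sections over `D(g) ⊆ Vᵢ` are
  fractions of sections over `Vᵢ`, and `g` is a unit on `D(g)`); `eq_of_app_eq_of_iSup_eq_top`;
* `exists_forall_mem_pow_smul_eq_zero` — **uniform torsion**: a finite module each of whose elements
  is killed by some power of each element of a finite set `S` is killed by a power of `span S`
  (Mathlib `Ideal.exists_pow_le_of_le_radical_of_fg`), and its geometric instance
  `exists_forall_mem_pow_smul_eq_zero_of_map_eq_zero` for the sections of an affine-localizing module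
  dying on the basic opens `D(g)`, `g ∈ S` (The Stacks Project, Tag 01YD).

Everything is proved; no named facts.

## References

* The Stacks Project, Tags 01YD (Lemma 30.10.2), 088B, 088C. [StacksProject]
* R. Hartshorne, *Algebraic Geometry*, Springer GTM 52 (1977), II Lemma 5.3 (p. 112), Ex. II.5.6. [Hartshorne1977]
-/

noncomputable section

-- `TopCat.Presheaf`/`Scheme.Modules` are not reducible (as in Mathlib's `AlgebraicGeometry/Modules`).
set_option backward.isDefEq.respectTransparency false

open CategoryTheory AlgebraicGeometry Limits TopologicalSpace Opposite

universe u

namespace Literature.AlgebraicGeometry.Modules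

open Literature.AlgebraicGeometry.Motives

variable {X : Scheme.{u}} {M N : X.Modules}

/-! ### Fractions on basic opens -/

/-- A section killed by a power of `g` on an open `W ⊆ D(g)` vanishes. [folklore] -/
theorem eq_zero_of_map_pow_smul_eq_zero {V W : X.Opens} (g : Γ(X, V)) (hWg : W ≤ X.basicOpen g)
    {y : Γ(N, W)} {n : ℕ}
    (h : X.presheaf.map (homOfLE (hWg.trans (X.basicOpen_le g))).op g ^ n • y = 0) : y = 0 :=
  (sections_pow_smul_bijective_of_le_basicOpen N g hWg n).1 (by simpa using h)

/-- **An additive, `Γ(V)`-equivariant map on `M(D(g))` killing the restrictions of all sections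
over the affine `V` vanishes** (`M` affine-localizing: sections over `D(g)` are fractions).
[folklore] -/
theorem eq_zero_of_forall_map_eq_zero (hM : IsAffineLocalizing M) {V : X.Opens} (hV : IsAffineOpen V)
    (g : Γ(X, V)) (T : Γ(M, X.basicOpen g) →+ Γ(N, X.basicOpen g))
    (hT : ∀ (r : Γ(X, V)) (s : Γ(M, X.basicOpen g)),
      T (X.presheaf.map (homOfLE (X.basicOpen_le g)).op r • s) =
        X.presheaf.map (homOfLE (X.basicOpen_le g)).op r • T s)
    (h0 : ∀ m : Γ(M, V), T (M.presheaf.map (homOfLE (X.basicOpen_le g)).op m) = 0)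
    (s : Γ(M, X.basicOpen g)) : T s = 0 := by
  obtain ⟨n, m, hm⟩ := hM.numerator hV g rfl s
  have h1 : X.presheaf.map (homOfLE (X.basicOpen_le g)).op g ^ n • T s = 0 := by
    rw [← map_pow, ← hT, map_pow, ← hm, h0]
  exact eq_zero_of_map_pow_smul_eq_zero (N := N) g le_rfl h1

/-! ### Vanishing of a morphism is local on sections over affine opens -/

/-- **A morphism out of an affine-localizing module vanishing on the sections over an affine open
cover vanishes.** [folklore] -/
theorem eq_zero_of_app_eq_zero_of_iSup_eq_top (φ : M ⟶ N) (hM : IsAffineLocalizing M) {ι : Type*}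
    (V : ι → X.affineOpens) (hcov : ⨆ i, ((V i : X.affineOpens) : X.Opens) = ⊤)
    (h : ∀ i, ∀ m : Γ(M, V i), φ.app (V i) m = 0) : φ = 0 := by
  refine Scheme.Modules.hom_ext _ _ fun U => ?_
  ext m
  change φ.app U m = 0
  refine section_eq_zero_of_locally N (φ.app U m) fun x hx => ?_
  have hxtop : x ∈ (⊤ : X.Opens) := trivial
  rw [← hcov] at hxtop
  obtain ⟨i, hxi⟩ := Opens.mem_iSup.mp hxtop
  obtain ⟨g, hgU, hxg⟩ := (V i).2.exists_basicOpen_le ⟨x, hx⟩ hxi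
  refine ⟨X.basicOpen g, hgU, hxg, ?_⟩
  have hWV : X.basicOpen g ≤ (V i : X.Opens) := X.basicOpen_le g
  rw [← Scheme.Modules.Hom.app_map_apply]
  refine eq_zero_of_forall_map_eq_zero hM (V i).2 g
    (AddMonoidHom.mk' (fun s => φ.app (X.basicOpen g) s) fun s s' => map_add _ s s')
    (fun r' s => Scheme.Modules.Hom.app_smul φ _ s) (fun m' => ?_) _
  change φ.app (X.basicOpen g) (M.presheaf.map (homOfLE hWV).op m') = 0
  rw [Scheme.Modules.Hom.app_map_apply, h i m', map_zero]

/-- Two morphisms out of an affine-localizing module agreeing on the sections over an affine open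
cover are equal. [folklore] -/
theorem eq_of_app_eq_of_iSup_eq_top (φ ψ : M ⟶ N) (hM : IsAffineLocalizing M) {ι : Type*}
    (V : ι → X.affineOpens) (hcov : ⨆ i, ((V i : X.affineOpens) : X.Opens) = ⊤)
    (h : ∀ i, ∀ m : Γ(M, V i), φ.app (V i) m = ψ.app (V i) m) : φ = ψ := by
  rw [← sub_eq_zero]
  refine eq_zero_of_app_eq_zero_of_iSup_eq_top _ hM V hcov fun i m => ?_
  rw [Scheme.Modules.Hom.sub_app]
  change φ.app (V i) m - ψ.app (V i) m = 0
  rw [h i m, sub_self]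

/-! ### Uniform torsion -/

/-- **Uniform torsion of finite modules**: if every element of a finite `R`-module `E` is killed by
some power of each element of a finite set `S ⊆ R`, then `(span S)ᵗ·E = 0` for some `t`.
[cite: StacksProject, Tag 01YD] -/
theorem exists_forall_mem_pow_smul_eq_zero {R : Type*} [CommRing R] {E : Type*} [AddCommGroup E]
    [Module R E] [Module.Finite R E] (S : Finset R)
    (h : ∀ g ∈ S, ∀ m : E, ∃ n : ℕ, g ^ n • m = 0) :
    ∃ t : ℕ, ∀ r ∈ Ideal.span (S : Set R) ^ t, ∀ m : E, r • m = 0 := by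
  classical
  -- `span S ≤ √(Ann E)`: each `g ∈ S` has a power killing the finitely many generators of `E`
  have hle : Ideal.span (S : Set R) ≤ (Module.annihilator R E).radical := by
    refine Ideal.span_le.mpr fun g hg => ?_
    obtain ⟨T, hT⟩ := Module.Finite.fg_top (R := R) (M := E)
    choose n hn using fun m : E => h g hg m
    refine ⟨T.sup n, Module.mem_annihilator.mpr fun m => ?_⟩
    have hm : m ∈ Submodule.span R (T : Set E) := by rw [hT]; trivial
    induction hm using Submodule.span_induction with
    | mem x hx =>
      obtain ⟨d, hd⟩ := Nat.exists_eq_add_of_le (Finset.le_sup (f := n) hx)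
      rw [hd, pow_add, mul_comm, mul_smul, hn x, smul_zero]
    | zero => rw [smul_zero]
    | add x y _ _ hx hy => rw [smul_add, hx, hy, add_zero]
    | smul c x _ hx => rw [smul_comm, hx, smul_zero]
  obtain ⟨t, ht⟩ := Ideal.exists_pow_le_of_le_radical_of_fg hle ⟨S, rfl⟩
  exact ⟨t, fun r hr m => Module.mem_annihilator.mp (ht hr) m⟩

/-- **A power of the ideal kills the sections** (Stacks Tag 01YD, affine form): let `M` be
affine-localizing with `M(V)` finite over `Γ(V, 𝒪_X)` (`V` affine) and let `S ⊆ Γ(V, 𝒪_X)` be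
finite; if every section of `M` over `V` restricts to zero on the basic opens `D(g)`, `g ∈ S`, then
`(span S)ᵗ·M(V) = 0` for some `t`. [cite: StacksProject, Tag 01YD] -/
theorem exists_forall_mem_pow_smul_eq_zero_of_map_eq_zero (hM : IsAffineLocalizing M) {V : X.Opens}
    (hV : IsAffineOpen V) [Module.Finite Γ(X, V) Γ(M, V)] (S : Finset Γ(X, V))
    (h : ∀ g ∈ S, ∀ m : Γ(M, V), M.presheaf.map (homOfLE (X.basicOpen_le g)).op m = 0) :
    ∃ t : ℕ, ∀ r ∈ Ideal.span (S : Set Γ(X, V)) ^ t, ∀ m : Γ(M, V), r • m = 0 :=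
  exists_forall_mem_pow_smul_eq_zero S fun g hg m =>
    hM.torsion hV g m (X.basicOpen_le g) le_rfl (h g hg m)

end Literature.AlgebraicGeometry.Modules

end
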